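import Summits.ValiantsHypothesis.ValiantsHypothesis.Theorems.SymPencilPerFourHyperplaneQuadKer

/-!
# Route `SymPencil` — the one-row pencil core of hyperplane flow rigidity, I: the `t`-orders,
# nilpotency, and the reduction to `X₂ = 0` plus a rank-one lemma (tool file, `--supports`
# stmt-ValiantsHypothesis-5674; nothing here bears on `VP ≠ VNP`)

Cell `(12,4,2)` of the size-27 kernel-package table is empty MODULO the hyperplane flow rigidity
statement `RIG_𝟙` (`SymPencilSdcPerFourCellTwelveFour`).  Its hard sub-case (memo
`Cruxes/SdcSuperquadratic/CELL-TWELVE-FOUR.md` §2(c), stub S1c) is the ONE-ROW PENCIL CORE: three linear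
maps `X₀, X₁, X₂` of `K⁴`, a hyperplane `L = ker μ`, and the block-diagonal flow

  `per [𝟙; a + t X₀ a; b + t X₁ b; c + t X₂ c] = per [𝟙; a; b; c]`   (`a, b ∈ K⁴`, `c ∈ L`, `t ∈ K`).

Write `T(a,b,c) = per [𝟙; a; b; c]` (symmetric, trilinear).  This file proves the first layer:

* `pencil_flow_orders`: the three `t`-orders
  (F1) `T(X₀a,b,c) + T(a,X₁b,c) + T(a,b,X₂c) = 0`,
  (F2) `T(X₀a,X₁b,c) + T(X₀a,b,X₂c) + T(a,X₁b,X₂c) = 0`,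
  (F3) `T(X₀a,X₁b,X₂c) = 0`;
* `per_X₁_X₂_eq`, `per_X₀_X₂_eq`: the mixed identities `T(a,X₁b,X₂c) = T(X₀²a,b,c)` and
  `T(X₀a,b,X₂c) = T(a,X₁²b,c)` ((F2) minus (F1) at `X₀a`, resp. at `X₁b`);
* `X₀_cube_eq_zero`, `X₁_cube_eq_zero`: `X₀³ = 0`, `X₁³ = 0` (from (F3) and the joint injectivity
  `eq_zero_of_per_eq_zero₁/₂` of `T(·,·,L)`, itself from `SymPencilPerFourBoxInjective.exists_injective_point`);
* `X₁_eq_neg_X₀_of_X₂_eq_zero`, `selfAdjoint_of_X₂_eq_zero`, `X₀_sq_eq_zero_of_X₂_eq_zero`: once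
  `X₂ = 0` on `L`, (F1) at `b = a` and the quadratic lemma `eq_zero_of_perm_quad_ker` give
  `X₁ = -X₀`, then `X₀` is `T(·,·,c)`-self-adjoint for every `c ∈ L` and (F2) gives `X₀² = 0`;
* `exists_kernel_hyperplane_of_X₂_eq_zero`: hence, GIVEN `X₂ = 0` on `L` and GIVEN that a
  `T(·,·,L)`-self-adjoint square-zero map has rank `≤ 1`, the conclusion of S1c:
  `∃ φ, (φ a = 0 → X₀ a = 0 ∧ X₁ a = 0)`.

What remains for S1c after this file: `X₂ = 0` on `L` (memo §5 (2)–(3)) and the rank-one lemma for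
nilpotent self-adjoint maps of the net `{Hess e₃(c) : c ∈ L}` (memo §5 (4)).  Elementary. [folklore]
-/

-- single-conjunct layout: Sub = Summit, duplicated namespace component intended
set_option linter.dupNamespace false

namespace Summit.ValiantsHypothesis.ValiantsHypothesis.Theorems.SymPencilPerFourHyperplanePencilOrders

open Matrix
open Summit.ValiantsHypothesis.ValiantsHypothesis.Theorems.SymPencilPerFourInnerRankRows
  (permanent_of_rows)
open Summit.ValiantsHypothesis.ValiantsHypothesis.Theorems.SymPencilPerFourBoxInjective
  (exists_injective_point)
open Summit.ValiantsHypothesis.ValiantsHypothesis.Theorems.SymPencilPerFourHyperplaneQuadKer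
  (eq_zero_of_perm_quad_ker)

variable {K : Type*} [Field K]

/-! ### Trilinear bookkeeping for `T(a,b,c) = per [𝟙; a; b; c]` -/

/-- Swap of the rows `a, b`. [folklore] -/
theorem per_swap₁₂ (a b c : Fin 4 → K) :
    (Matrix.of ![(fun _ => (1 : K)), a, b, c]).permanent =
      (Matrix.of ![(fun _ => (1 : K)), b, a, c]).permanent := by
  simp only [permanent_of_rows]; ring

/-- Swap of the rows `b, c`. [folklore] -/
theorem per_swap₂₃ (a b c : Fin 4 → K) :
    (Matrix.of ![(fun _ => (1 : K)), a, b, c]).permanent =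
      (Matrix.of ![(fun _ => (1 : K)), a, c, b]).permanent := by
  simp only [permanent_of_rows]; ring

/-- Additivity in the row `a`. [folklore] -/
theorem per_add₁ (a a' b c : Fin 4 → K) :
    (Matrix.of ![(fun _ => (1 : K)), a + a', b, c]).permanent =
      (Matrix.of ![(fun _ => (1 : K)), a, b, c]).permanent +
        (Matrix.of ![(fun _ => (1 : K)), a', b, c]).permanent := by
  simp only [permanent_of_rows, Pi.add_apply]; ring

/-- Homogeneity in the row `a`. [folklore] -/
theorem per_smul₁ (s : K) (a b c : Fin 4 → K) :
    (Matrix.of ![(fun _ => (1 : K)), s • a, b, c]).permanent =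
      s * (Matrix.of ![(fun _ => (1 : K)), a, b, c]).permanent := by
  simp only [permanent_of_rows, Pi.smul_apply, smul_eq_mul]; ring

/-- Negation in the row `a`. [folklore] -/
theorem per_neg₁ (a b c : Fin 4 → K) :
    (Matrix.of ![(fun _ => (1 : K)), -a, b, c]).permanent =
      -(Matrix.of ![(fun _ => (1 : K)), a, b, c]).permanent := by
  simp only [permanent_of_rows, Pi.neg_apply]; ring

/-- The cubic expansion of `T(a + t u, b + t v, c + t w)` in `t`. [folklore] -/
theorem per_flow_expand (a b c u v w : Fin 4 → K) (t : K) :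
    (Matrix.of ![(fun _ => (1 : K)), a + t • u, b + t • v, c + t • w]).permanent =
      (Matrix.of ![(fun _ => (1 : K)), a, b, c]).permanent +
      t * ((Matrix.of ![(fun _ => (1 : K)), u, b, c]).permanent +
            (Matrix.of ![(fun _ => (1 : K)), a, v, c]).permanent +
            (Matrix.of ![(fun _ => (1 : K)), a, b, w]).permanent) +
      t ^ 2 * ((Matrix.of ![(fun _ => (1 : K)), u, v, c]).permanent +
            (Matrix.of ![(fun _ => (1 : K)), u, b, w]).permanent +
            (Matrix.of ![(fun _ => (1 : K)), a, v, w]).permanent) +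
      t ^ 3 * (Matrix.of ![(fun _ => (1 : K)), u, v, w]).permanent := by
  simp only [permanent_of_rows, Pi.add_apply, Pi.smul_apply, smul_eq_mul]; ring

/-- Vandermonde at `t = 1, -1, 2`: a cubic `t P₁ + t² P₂ + t³ P₃` vanishing at these points is zero
(characteristic zero). [folklore] -/
theorem coeffs_eq_zero [CharZero K] {P₁ P₂ P₃ : K}
    (h : ∀ t : K, t * P₁ + t ^ 2 * P₂ + t ^ 3 * P₃ = 0) : P₁ = 0 ∧ P₂ = 0 ∧ P₃ = 0 := by
  have h1 := h 1
  have h2 := h (-1)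
  have h3 := h 2
  have hP₂ : P₂ = 0 := by linear_combination (h1 + h2) / 2
  have hP₃ : P₃ = 0 := by
    have : (6 : K) * P₃ = 0 := by linear_combination h3 - (h1 - h2) - 4 * hP₂
    exact (mul_eq_zero.1 this).resolve_left (by norm_num)
  exact ⟨by linear_combination (h1 - h2) / 2 - hP₃, hP₂, hP₃⟩

/-! ### Joint injectivity of `T(·, ·, L)` -/

variable [CharZero K]

/-- **Joint injectivity, first slot**: if `T(w, b, c) = 0` for all `b` and all `c ∈ ker μ`, then
`w = 0`. [folklore] -/
theorem eq_zero_of_per_eq_zero₁ (μ : (Fin 4 → K) →ₗ[K] K) (w : Fin 4 → K)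
    (h : ∀ b c : Fin 4 → K, μ c = 0 →
      (Matrix.of ![(fun _ => (1 : K)), w, b, c]).permanent = 0) : w = 0 := by
  obtain ⟨c₀, hc₀, hinj⟩ := exists_injective_point μ
  exact hinj w fun k => by rw [per_swap₁₂]; exact h _ _ hc₀

/-- **Joint injectivity, middle slot**: if `T(a, w, c) = 0` for all `a` and all `c ∈ ker μ`, then
`w = 0`. [folklore] -/
theorem eq_zero_of_per_eq_zero₂ (μ : (Fin 4 → K) →ₗ[K] K) (w : Fin 4 → K)
    (h : ∀ a c : Fin 4 → K, μ c = 0 →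
      (Matrix.of ![(fun _ => (1 : K)), a, w, c]).permanent = 0) : w = 0 := by
  obtain ⟨c₀, hc₀, hinj⟩ := exists_injective_point μ
  exact hinj w fun k => h _ _ hc₀

/-! ### The `t`-orders of the block-diagonal flow -/

/-- **The three `t`-orders (F1), (F2), (F3)** of the pencil flow. [folklore] -/
theorem pencil_flow_orders (X₀ X₁ X₂ : (Fin 4 → K) →ₗ[K] (Fin 4 → K)) (μ : (Fin 4 → K) →ₗ[K] K)
    (h : ∀ (a b c : Fin 4 → K) (t : K), μ c = 0 →
      (Matrix.of ![(fun _ => (1 : K)), a + t • X₀ a, b + t • X₁ b, c + t • X₂ c]).permanent =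
        (Matrix.of ![(fun _ => (1 : K)), a, b, c]).permanent)
    (a b c : Fin 4 → K) (hc : μ c = 0) :
    ((Matrix.of ![(fun _ => (1 : K)), X₀ a, b, c]).permanent +
        (Matrix.of ![(fun _ => (1 : K)), a, X₁ b, c]).permanent +
        (Matrix.of ![(fun _ => (1 : K)), a, b, X₂ c]).permanent = 0) ∧
    ((Matrix.of ![(fun _ => (1 : K)), X₀ a, X₁ b, c]).permanent +
        (Matrix.of ![(fun _ => (1 : K)), X₀ a, b, X₂ c]).permanent +
        (Matrix.of ![(fun _ => (1 : K)), a, X₁ b, X₂ c]).permanent = 0) ∧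
    (Matrix.of ![(fun _ => (1 : K)), X₀ a, X₁ b, X₂ c]).permanent = 0 := by
  refine coeffs_eq_zero fun t => ?_
  have ht := h a b c t hc
  rw [per_flow_expand] at ht
  linear_combination ht

/-- **Mixed identity** `T(a, X₁ b, X₂ c) = T(X₀² a, b, c)` on `c ∈ ker μ` ((F2) minus (F1) at `X₀ a`).
[folklore] -/
theorem per_X₁_X₂_eq (X₀ X₁ X₂ : (Fin 4 → K) →ₗ[K] (Fin 4 → K)) (μ : (Fin 4 → K) →ₗ[K] K)
    (h : ∀ (a b c : Fin 4 → K) (t : K), μ c = 0 →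
      (Matrix.of ![(fun _ => (1 : K)), a + t • X₀ a, b + t • X₁ b, c + t • X₂ c]).permanent =
        (Matrix.of ![(fun _ => (1 : K)), a, b, c]).permanent)
    (a b c : Fin 4 → K) (hc : μ c = 0) :
    (Matrix.of ![(fun _ => (1 : K)), a, X₁ b, X₂ c]).permanent =
      (Matrix.of ![(fun _ => (1 : K)), X₀ (X₀ a), b, c]).permanent := by
  have h2 := (pencil_flow_orders X₀ X₁ X₂ μ h a b c hc).2.1
  have h1 := (pencil_flow_orders X₀ X₁ X₂ μ h (X₀ a) b c hc).1
  linear_combination h2 - h1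

/-- **Mixed identity** `T(X₀ a, b, X₂ c) = T(a, X₁² b, c)` on `c ∈ ker μ` ((F2) minus (F1) at `X₁ b`).
[folklore] -/
theorem per_X₀_X₂_eq (X₀ X₁ X₂ : (Fin 4 → K) →ₗ[K] (Fin 4 → K)) (μ : (Fin 4 → K) →ₗ[K] K)
    (h : ∀ (a b c : Fin 4 → K) (t : K), μ c = 0 →
      (Matrix.of ![(fun _ => (1 : K)), a + t • X₀ a, b + t • X₁ b, c + t • X₂ c]).permanent =
        (Matrix.of ![(fun _ => (1 : K)), a, b, c]).permanent)
    (a b c : Fin 4 → K) (hc : μ c = 0) :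
    (Matrix.of ![(fun _ => (1 : K)), X₀ a, b, X₂ c]).permanent =
      (Matrix.of ![(fun _ => (1 : K)), a, X₁ (X₁ b), c]).permanent := by
  have h2 := (pencil_flow_orders X₀ X₁ X₂ μ h a b c hc).2.1
  have h1 := (pencil_flow_orders X₀ X₁ X₂ μ h a (X₁ b) c hc).1
  linear_combination h2 - h1

/-- **Nilpotency of `X₀`**: `X₀³ = 0`. [folklore] -/
theorem X₀_cube_eq_zero (X₀ X₁ X₂ : (Fin 4 → K) →ₗ[K] (Fin 4 → K)) (μ : (Fin 4 → K) →ₗ[K] K)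
    (h : ∀ (a b c : Fin 4 → K) (t : K), μ c = 0 →
      (Matrix.of ![(fun _ => (1 : K)), a + t • X₀ a, b + t • X₁ b, c + t • X₂ c]).permanent =
        (Matrix.of ![(fun _ => (1 : K)), a, b, c]).permanent)
    (a : Fin 4 → K) : X₀ (X₀ (X₀ a)) = 0 := by
  refine eq_zero_of_per_eq_zero₁ μ _ fun b c hc => ?_
  rw [← per_X₁_X₂_eq X₀ X₁ X₂ μ h (X₀ a) b c hc]
  exact (pencil_flow_orders X₀ X₁ X₂ μ h a b c hc).2.2

/-- **Nilpotency of `X₁`**: `X₁³ = 0`. [folklore] -/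
theorem X₁_cube_eq_zero (X₀ X₁ X₂ : (Fin 4 → K) →ₗ[K] (Fin 4 → K)) (μ : (Fin 4 → K) →ₗ[K] K)
    (h : ∀ (a b c : Fin 4 → K) (t : K), μ c = 0 →
      (Matrix.of ![(fun _ => (1 : K)), a + t • X₀ a, b + t • X₁ b, c + t • X₂ c]).permanent =
        (Matrix.of ![(fun _ => (1 : K)), a, b, c]).permanent)
    (b : Fin 4 → K) : X₁ (X₁ (X₁ b)) = 0 := by
  refine eq_zero_of_per_eq_zero₂ μ _ fun a c hc => ?_
  rw [← per_X₀_X₂_eq X₀ X₁ X₂ μ h a (X₁ b) c hc]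
  exact (pencil_flow_orders X₀ X₁ X₂ μ h a b c hc).2.2

/-! ### The reduction once `X₂ = 0` on `ker μ` -/

/-- **`X₁ = -X₀` once `X₂` vanishes on `ker μ`**: (F1) at `b = a` is `T((X₀+X₁)a, a, c) = 0`, and the
quadratic lemma with the last row on a hyperplane concludes. [folklore] -/
theorem X₁_eq_neg_X₀_of_X₂_eq_zero (X₀ X₁ X₂ : (Fin 4 → K) →ₗ[K] (Fin 4 → K))
    (μ : (Fin 4 → K) →ₗ[K] K)
    (h : ∀ (a b c : Fin 4 → K) (t : K), μ c = 0 →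
      (Matrix.of ![(fun _ => (1 : K)), a + t • X₀ a, b + t • X₁ b, c + t • X₂ c]).permanent =
        (Matrix.of ![(fun _ => (1 : K)), a, b, c]).permanent)
    (hZ : ∀ c, μ c = 0 → X₂ c = 0) : X₁ = -X₀ := by
  have hS : X₀ + X₁ = 0 := by
    refine eq_zero_of_perm_quad_ker μ (X₀ + X₁) fun u z hz => ?_
    have h1 := (pencil_flow_orders X₀ X₁ X₂ μ h u u z hz).1
    rw [hZ z hz] at h1
    rw [LinearMap.add_apply, per_add₁, per_swap₁₂ (X₁ u)]
    have h0 : (Matrix.of ![(fun _ => (1 : K)), u, u, (0 : Fin 4 → K)]).permanent = 0 := by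
      simp only [permanent_of_rows, Pi.zero_apply]; ring
    linear_combination h1 - h0
  exact eq_neg_of_add_eq_zero_right hS

/-- **Self-adjointness once `X₂` vanishes on `ker μ`**: `T(X₀ a, b, c) = T(a, X₀ b, c)` for
`c ∈ ker μ`. [folklore] -/
theorem selfAdjoint_of_X₂_eq_zero (X₀ X₁ X₂ : (Fin 4 → K) →ₗ[K] (Fin 4 → K))
    (μ : (Fin 4 → K) →ₗ[K] K)
    (h : ∀ (a b c : Fin 4 → K) (t : K), μ c = 0 →
      (Matrix.of ![(fun _ => (1 : K)), a + t • X₀ a, b + t • X₁ b, c + t • X₂ c]).permanent =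
        (Matrix.of ![(fun _ => (1 : K)), a, b, c]).permanent)
    (hZ : ∀ c, μ c = 0 → X₂ c = 0) (a b c : Fin 4 → K) (hc : μ c = 0) :
    (Matrix.of ![(fun _ => (1 : K)), X₀ a, b, c]).permanent =
      (Matrix.of ![(fun _ => (1 : K)), a, X₀ b, c]).permanent := by
  have h1 := (pencil_flow_orders X₀ X₁ X₂ μ h a b c hc).1
  rw [hZ c hc, X₁_eq_neg_X₀_of_X₂_eq_zero X₀ X₁ X₂ μ h hZ, LinearMap.neg_apply,
    per_swap₁₂ a, per_neg₁, per_swap₁₂ (X₀ b)] at h1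
  have h0 : (Matrix.of ![(fun _ => (1 : K)), a, b, (0 : Fin 4 → K)]).permanent = 0 := by
    simp only [permanent_of_rows, Pi.zero_apply]; ring
  linear_combination h1 - h0

/-- **`X₀² = 0` once `X₂` vanishes on `ker μ`**: (F2) reads `T(X₀ a, X₀ b, c) = 0`, i.e.
`T(a, X₀² b, c) = 0`, for `c ∈ ker μ`. [folklore] -/
theorem X₀_sq_eq_zero_of_X₂_eq_zero (X₀ X₁ X₂ : (Fin 4 → K) →ₗ[K] (Fin 4 → K))
    (μ : (Fin 4 → K) →ₗ[K] K)
    (h : ∀ (a b c : Fin 4 → K) (t : K), μ c = 0 →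
      (Matrix.of ![(fun _ => (1 : K)), a + t • X₀ a, b + t • X₁ b, c + t • X₂ c]).permanent =
        (Matrix.of ![(fun _ => (1 : K)), a, b, c]).permanent)
    (hZ : ∀ c, μ c = 0 → X₂ c = 0) (b : Fin 4 → K) : X₀ (X₀ b) = 0 := by
  refine eq_zero_of_per_eq_zero₂ μ _ fun a c hc => ?_
  have h2 := (pencil_flow_orders X₀ X₁ X₂ μ h a b c hc).2.1
  rw [hZ c hc, X₁_eq_neg_X₀_of_X₂_eq_zero X₀ X₁ X₂ μ h hZ, LinearMap.neg_apply,
    per_swap₁₂ (X₀ a), per_neg₁, per_swap₁₂ (X₀ b),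
    selfAdjoint_of_X₂_eq_zero X₀ X₁ X₂ μ h hZ a (X₀ b) c hc] at h2
  have h0 : (Matrix.of ![(fun _ => (1 : K)), X₀ a, b, (0 : Fin 4 → K)]).permanent = 0 := by
    simp only [permanent_of_rows, Pi.zero_apply]; ring
  have h0' : (Matrix.of ![(fun _ => (1 : K)), a, -X₀ b, (0 : Fin 4 → K)]).permanent = 0 := by
    simp only [permanent_of_rows, Pi.zero_apply]; ring
  linear_combination -(h2 - h0 - h0')

/-- **S1c reduced to `X₂ = 0` and a rank-one lemma.**  If `X₂` vanishes on `ker μ`, and every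
`T(·,·,ker μ)`-self-adjoint square-zero linear map of `K⁴` has rank `≤ 1` (hypothesis `hrank`,
memo §5 (4)), then `X₀, X₁` vanish on a common hyperplane `ker φ` (or identically, `φ = 0`).
[folklore] -/
theorem exists_kernel_hyperplane_of_X₂_eq_zero (X₀ X₁ X₂ : (Fin 4 → K) →ₗ[K] (Fin 4 → K))
    (μ : (Fin 4 → K) →ₗ[K] K)
    (h : ∀ (a b c : Fin 4 → K) (t : K), μ c = 0 →
      (Matrix.of ![(fun _ => (1 : K)), a + t • X₀ a, b + t • X₁ b, c + t • X₂ c]).permanent =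
        (Matrix.of ![(fun _ => (1 : K)), a, b, c]).permanent)
    (hZ : ∀ c, μ c = 0 → X₂ c = 0)
    (hrank : ∀ A : (Fin 4 → K) →ₗ[K] (Fin 4 → K),
      (∀ a b c : Fin 4 → K, μ c = 0 →
        (Matrix.of ![(fun _ => (1 : K)), A a, b, c]).permanent =
          (Matrix.of ![(fun _ => (1 : K)), a, A b, c]).permanent) →
      (∀ a, A (A a) = 0) →
      ∃ (w : Fin 4 → K) (φ : (Fin 4 → K) →ₗ[K] K), ∀ a, A a = φ a • w) :
    ∃ φ : (Fin 4 → K) →ₗ[K] K,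
      (∀ a, φ a = 0 → X₀ a = 0 ∧ X₁ a = 0) ∧ (∀ c, μ c = 0 → X₂ c = 0) := by
  obtain ⟨w, φ, hφ⟩ := hrank X₀ (selfAdjoint_of_X₂_eq_zero X₀ X₁ X₂ μ h hZ)
    (X₀_sq_eq_zero_of_X₂_eq_zero X₀ X₁ X₂ μ h hZ)
  refine ⟨φ, fun a ha => ?_, hZ⟩
  have h0 : X₀ a = 0 := by rw [hφ a, ha, zero_smul]
  refine ⟨h0, ?_⟩
  rw [X₁_eq_neg_X₀_of_X₂_eq_zero X₀ X₁ X₂ μ h hZ, LinearMap.neg_apply, h0, neg_zero]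

end Summit.ValiantsHypothesis.ValiantsHypothesis.Theorems.SymPencilPerFourHyperplanePencilOrders
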